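import Summits.AtomisticToContinuum.Crystallization.Theorems.UniformBindingRigidity.Negative.LoadBearing

/-!
# Negative knowledge for crux `PerronTransitivity.UniformBindingRigidity` (stmt-AtomisticToContinuum-15099), IV:
# the binding hypothesis alone forces local finiteness (hypothesis "uniformly discrete" is half redundant)

Refuter vetting (crux disprover, mutation of hypothesis (2), `--supports stmt-AtomisticToContinuum-15099`).
The crux M* assumes (1) `X.Nonempty`, (2) `X` uniformly discrete, (3) every site bound
`U_X(p) = ∑'_{q ∈ X, q ≠ p} V_LJ(dist p q) ≤ 2E*`.  Dropping (2) does NOT admit wild witnesses with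
accumulation points: if `z` is an accumulation point of `X` and `p ∈ X` has `0 < dist p z ≤ 1/2`, then
infinitely many terms of the site family at `p` are close to `V_LJ(dist p z) > 0`, the family is not
summable, its `tsum` is the junk value `0 > 2E*` (part I, `LoadBearing.not_bound_of_not_summable`), and (3)
fails at `p`.  Hence

* `finite_inter_closedBall_of_bound` — under (3) alone, `X` meets every closed ball in a finite set;
* `finite_of_bound_of_isBounded` — every bounded subset of such an `X` is finite.

So hypothesis (2) is load-bearing at most for the gap between "locally finite" and "uniformly discrete";
whether (3) forces uniform discreteness (full redundancy) is open, and a counterexample could not be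
certified anyway (it would have to be certified INSIDE the uniformly-`2E*`-bound class, i.e. carry a sharp
lower bound on the periodic Lennard-Jones ground-state energy — see the crux's `Disproof.lean`, §3).
All `[folklore]`.
-/

noncomputable section

namespace Summit.AtomisticToContinuum.Crystallization.Theorems.UniformBindingRigidity.Negative.LocallyFinite

open scoped BigOperators Topology
open Filter Set Metric
open Literature.MathematicalPhysics.StatisticalMechanics

/-- `V_LJ(r) > 0` for `0 < r ≤ 1/2` (indeed for `r < 2^{-1/6}`). [folklore] -/
theorem lennardJones_pos_of_le_half {r : ℝ} (hr0 : 0 < r) (hr : r ≤ 1 / 2) : 0 < lennardJones r := by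
  unfold lennardJones
  have h2 : (2 : ℝ) ≤ r⁻¹ := by
    rw [le_inv_comm₀ two_pos hr0]; linarith
  have h6 : (64 : ℝ) ≤ (r⁻¹) ^ 6 := by
    calc (64 : ℝ) = 2 ^ 6 := by norm_num
      _ ≤ (r⁻¹) ^ 6 := pow_le_pow_left₀ (by norm_num) h2 6
  have h12 : (r⁻¹) ^ 12 = (r⁻¹) ^ 6 * (r⁻¹) ^ 6 := by ring
  rw [h12]
  nlinarith [h6]

/-- `V_LJ` is continuous away from `0`. [folklore] -/
theorem continuousAt_lennardJones {r : ℝ} (hr : r ≠ 0) : ContinuousAt lennardJones r := by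
  have h : ContinuousAt (fun s : ℝ => s⁻¹) r := continuousAt_inv₀ hr
  unfold lennardJones
  exact ((h.pow 12).const_mul (1 / 12)).sub ((h.pow 6).const_mul (1 / 6))

/-- **Binding forces local finiteness.** If every site of `X ⊆ ℝ³` satisfies the binding inequality of
the crux (hypothesis (3)), then `X` meets every closed ball in a finite set — with NO discreteness
hypothesis. [folklore] -/
theorem finite_inter_closedBall_of_bound {X : Set (EuclideanSpace ℝ (Fin 3))}
    (hB : ∀ p ∈ X, ∑' q : {q : EuclideanSpace ℝ (Fin 3) // q ∈ X ∧ q ≠ p}, lennardJones (dist p q.1) ≤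
      2 * ⨅ Q : PeriodicConfiguration 3, Q.energyPerParticle lennardJones)
    (c : EuclideanSpace ℝ (Fin 3)) (R : ℝ) : (X ∩ closedBall c R).Finite := by
  classical
  by_contra hinf
  have hinf' : (X ∩ closedBall c R).Infinite := hinf
  -- an injective sequence in `X ∩ closedBall c R`, and a convergent subsequence (Bolzano–Weierstrass)
  set x : ℕ → EuclideanSpace ℝ (Fin 3) := fun n => (hinf'.natEmbedding _ n : EuclideanSpace ℝ (Fin 3))
    with hx
  have hx_mem : ∀ n, x n ∈ X ∧ x n ∈ closedBall c R := fun n => (hinf'.natEmbedding _ n).2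
  have hx_inj : Function.Injective x := fun m n h =>
    (hinf'.natEmbedding _).injective (Subtype.ext h)
  obtain ⟨z, -, φ, hφ, hz⟩ := (isCompact_closedBall c R).tendsto_subseq fun n => (hx_mem n).2
  set y : ℕ → EuclideanSpace ℝ (Fin 3) := x ∘ φ with hy
  have hy_inj : Function.Injective y := hx_inj.comp hφ.injective
  have hy_mem : ∀ n, y n ∈ X := fun n => (hx_mem (φ n)).1
  -- a site `p = y K ≠ z` with `dist p z < 1/2`
  obtain ⟨N, hN⟩ := Metric.tendsto_atTop.1 hz (1 / 2) (by norm_num)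
  obtain ⟨K, hKN, hKz⟩ : ∃ K, N ≤ K ∧ y K ≠ z := by
    by_cases h : y N = z
    · refine ⟨N + 1, N.le_succ, fun h' => ?_⟩
      exact absurd (hy_inj (h.trans h'.symm)) (Nat.succ_ne_self N).symm
    · exact ⟨N, le_rfl, h⟩
  set p : EuclideanSpace ℝ (Fin 3) := y K with hp
  set r : ℝ := dist p z with hr
  have hr0 : 0 < r := dist_pos.2 hKz
  have hr2 : r < 1 / 2 := hN K hKN
  have hV : 0 < lennardJones r := lennardJones_pos_of_le_half hr0 hr2.le
  -- the site family at `p` is not summable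
  have hns : ¬ Summable (fun q : {q : EuclideanSpace ℝ (Fin 3) // q ∈ X ∧ q ≠ p} =>
      lennardJones (dist p q.1)) := by
    intro hs
    -- finitely many terms are `≥ V(r)/2`
    have hev : ∀ᶠ q in cofinite,
        lennardJones (dist p (q : {q : EuclideanSpace ℝ (Fin 3) // q ∈ X ∧ q ≠ p}).1) <
          lennardJones r / 2 :=
      hs.tendsto_cofinite_zero.eventually (gt_mem_nhds (by linarith))
    have hfin : {q : {q : EuclideanSpace ℝ (Fin 3) // q ∈ X ∧ q ≠ p} |
        ¬ lennardJones (dist p q.1) < lennardJones r / 2}.Finite :=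
      Filter.eventually_cofinite.1 hev
    -- but along the sequence the terms tend to `V(r)`
    have hcont : Tendsto (fun n => lennardJones (dist p (y n))) atTop (𝓝 (lennardJones r)) :=
      (continuousAt_lennardJones hr0.ne').tendsto.comp (tendsto_const_nhds.dist hz)
    obtain ⟨M, hM⟩ := Metric.tendsto_atTop.1 hcont (lennardJones r / 2) (by linarith)
    -- the injection `n ↦ y (n + L)` of `ℕ` into that finite set
    set L : ℕ := max M (K + 1) with hL
    have hneK : ∀ n, n + L ≠ K := fun n => by
      have : K + 1 ≤ n + L := le_trans (le_max_right _ _) (Nat.le_add_left _ _)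
      omega
    let g : ℕ → {q : EuclideanSpace ℝ (Fin 3) // q ∈ X ∧ q ≠ p} := fun n =>
      ⟨y (n + L), hy_mem _, fun h => hneK n (hy_inj h)⟩
    have hg_inj : Function.Injective g := fun m n h => by
      have : y (m + L) = y (n + L) :=
        congrArg (fun q : {q : EuclideanSpace ℝ (Fin 3) // q ∈ X ∧ q ≠ p} => q.1) h
      exact Nat.add_right_cancel (hy_inj this)
    have hg_mem : ∀ n, g n ∈ {q : {q : EuclideanSpace ℝ (Fin 3) // q ∈ X ∧ q ≠ p} |
        ¬ lennardJones (dist p q.1) < lennardJones r / 2} := fun n => by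
      have h1 : dist (lennardJones (dist p (y (n + L)))) (lennardJones r) < lennardJones r / 2 :=
        hM (n + L) (le_trans (le_max_left _ _) (Nat.le_add_left _ _))
      rw [Real.dist_eq, abs_lt] at h1
      show ¬ lennardJones (dist p (y (n + L))) < lennardJones r / 2
      push Not
      linarith [h1.1]
    have hinfty : (Set.range g).Infinite := Set.infinite_range_of_injective hg_inj
    exact hinfty (hfin.subset (Set.range_subset_iff.2 hg_mem))
  exact LoadBearing.not_bound_of_not_summable hns (hB p (hy_mem K))

/-- Corollary: under the binding hypothesis alone every bounded subset of `X` is finite (`X` is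
countable and locally finite). [folklore] -/
theorem finite_of_bound_of_isBounded {X : Set (EuclideanSpace ℝ (Fin 3))}
    (hB : ∀ p ∈ X, ∑' q : {q : EuclideanSpace ℝ (Fin 3) // q ∈ X ∧ q ≠ p}, lennardJones (dist p q.1) ≤
      2 * ⨅ Q : PeriodicConfiguration 3, Q.energyPerParticle lennardJones)
    {S : Set (EuclideanSpace ℝ (Fin 3))} (hS : S ⊆ X) (hbdd : Bornology.IsBounded S) : S.Finite := by
  obtain ⟨R, hR⟩ := hbdd.subset_closedBall 0
  exact (finite_inter_closedBall_of_bound hB 0 R).subset fun q hq => ⟨hS hq, hR hq⟩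

/-- **The variant of M* without hypothesis (2) is equivalent to the variant with (2) weakened to local
finiteness** — because (3) already gives local finiteness.  (Whether it is equivalent to M* itself, i.e.
whether (3) gives UNIFORM discreteness, is open.) [folklore] -/
theorem dropTwo_iff_locallyFinite (C : Set (EuclideanSpace ℝ (Fin 3)) → Prop) :
    (∀ X : Set (EuclideanSpace ℝ (Fin 3)), X.Nonempty →
      (∀ p ∈ X, ∑' q : {q : EuclideanSpace ℝ (Fin 3) // q ∈ X ∧ q ≠ p}, lennardJones (dist p q.1) ≤
        2 * ⨅ Q : PeriodicConfiguration 3, Q.energyPerParticle lennardJones) → C X) ↔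
    (∀ X : Set (EuclideanSpace ℝ (Fin 3)), X.Nonempty →
      (∀ (c : EuclideanSpace ℝ (Fin 3)) (R : ℝ), (X ∩ closedBall c R).Finite) →
      (∀ p ∈ X, ∑' q : {q : EuclideanSpace ℝ (Fin 3) // q ∈ X ∧ q ≠ p}, lennardJones (dist p q.1) ≤
        2 * ⨅ Q : PeriodicConfiguration 3, Q.energyPerParticle lennardJones) → C X) :=
  ⟨fun h X hne _ hB => h X hne hB,
    fun h X hne hB => h X hne (finite_inter_closedBall_of_bound hB) hB⟩

end Summit.AtomisticToContinuum.Crystallization.Theorems.UniformBindingRigidity.Negative.LocallyFinite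

end
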